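import Literature.Probability.LatticeModels.SixVertexSpectralPsiDeterminesMeasure
import Literature.Probability.LatticeModels.SixVertexSpectralLimitLemmas

/-!
# Six-vertex spectral measures: convergence to the GFF spectral measure (DKLM 2026, Part II,
# Theorem 53, the uniqueness step)

H. Duminil-Copin, K. K. Kozlowski, P. Lammers, I. Manolescu, *Gaussian free field convergence of
the six-vertex model with `-1 ≤ Δ ≤ -1/2`*, arXiv:2603.06268 (2026) [DKLM2026SixVertexGFF]
(`paper:arxiv-2603.06268`, chunk p0036):

> **Theorem 53 (Limit of the spectral measures).** […] If
> `lim_{L→∞} lim_{δ→0} Φ₂^{(δL;δ)}|_K = σ₀² Ψ₂^GFF|_K` […] then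
> `lim_{L→∞} lim_{δ→0} μ_L^{(4δL)} = μ_GFF := ½(δ_{b-a} + δ_{b+a}) · σ₀²/(2πa) 𝟙_{a>0} da db`, where
> the convergence is meant in `𝓜` (in the vague topology) […]
>
> *Proof.* […] In particular any sub-sequential limit `μ` of `μ_L^{(4δL)}` satisfies, for every
> `t > 0`, `∫ a e^{-at} dμ(a,b) = σ₀²/(2πt)` […] Since `μ_GFF` is uniquely characterised by its
> Laplace transform, we conclude that `μ^{(4δL)}_L` converges to `μ_GFF` as `δ → 0` and then
> `L → ∞` […]

This file assembles the **uniqueness step** at the level of a full-plane spectral measure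
`μ_∞ ∈ 𝓜_{c,C}` (the vague limits of the `μ_L`, Lemma 32) and its scalings `μ_∞^{(δ)}`
(§1.2.3, Definition 33): if every convergence sequence `(δ_n, μ)` of `μ_∞` has `μ = μ_{σ}` — in
particular (by `SixVertexSpectralPsiDeterminesMeasure.lean`) if every such `μ` has two-point
function `Ψ_μ = σ² Ψ₂^GFF` — then `μ_∞^{(δ)} → μ_σ` vaguely as `δ → 0⁺` (subsequence principle
and Lemma 31 (i)); and `Ψ_μ = σ² Ψ₂^GFF` holds as soon as the lattice two-point function
represented by `μ_∞` (`Φ₂ = ∫ χ^discr dμ_∞`, Theorem 23 with Lemma 32) converges to `σ² Ψ₂^GFF`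
along the scalings (Lemma 34, `scalingLimit_spectral_representation'`).

* `halfPlaneVagueTendsto_of_subseq` — the subsequence principle for vague convergence;
* **`halfPlaneVagueTendsto_gff_of_forall_isConvergenceSeq`**,
  **`halfPlaneVagueTendsto_gff_of_forall_dklmPsi_eq`** — `μ_∞^{(δ)} → μ_σ`;
* `tendsto_mul_natFloor_div`, `tendsto_mul_natCeil_div`, `tendsto_mul_intFloor_div` (lattice
  approximation of points), **`dklmPsi_eq_gff_of_tendsto_twoPoint`** (Lemma 34 + convergence of
  the lattice two-point function of two HORIZONTAL pairs ⇒ `Ψ_μ = σ² Ψ₂^GFF` on the configurations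
  `(m+1, 0, x₁', y₁', x₂, 0)`, which is all that the "simple exercise" needs),
  **`halfPlaneVagueTendsto_gff_of_tendsto_twoPoint`** — Theorem 53 for `μ_∞`.

## References

* H. Duminil-Copin, K. K. Kozlowski, P. Lammers, I. Manolescu, arXiv:2603.06268 (2026), Part II,
  Theorem 53 and its proof; Lemma 31 (i), Definition 33, Lemma 34. [DKLM2026SixVertexGFF]
-/

noncomputable section

open MeasureTheory Set Filter Topology Complex

namespace Literature.Probability.LatticeModels.SixVertex

variable {c C : ℝ}

/-! ## 1. The subsequence principle for vague convergence -/

/-- **Subsequence principle**: if every subsequence of `(ν_n)` has a further subsequence converging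
vaguely (on the half-plane) to `ν`, then `ν_n → ν` vaguely. [folklore] -/
theorem halfPlaneVagueTendsto_of_subseq {νs : ℕ → Measure (ℝ × ℝ)} {ν : Measure (ℝ × ℝ)}
    (h : ∀ φ : ℕ → ℕ, StrictMono φ → ∃ ψ : ℕ → ℕ, StrictMono ψ ∧ HalfPlaneVagueTendsto (νs ∘ φ ∘ ψ) ν) :
    HalfPlaneVagueTendsto νs ν := by
  intro f hf hsupp hpos
  refine tendsto_of_subseq_tendsto fun ns hns => ?_
  obtain ⟨φ₀, hφ₀, hmono⟩ := strictMono_subseq_of_tendsto_atTop hns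
  obtain ⟨ψ, hψ, hv⟩ := h (ns ∘ φ₀) hmono
  exact ⟨φ₀ ∘ ψ, hv f hf hsupp hpos⟩

/-! ## 2. `μ_∞^{(δ)} → μ_σ` from the identification of all convergence-sequence limits -/

/-- **Theorem 53, uniqueness step**: if every convergence sequence of `μ_∞ ∈ 𝓜_{c,C}` has limit
`μ_σ`, then `μ_∞^{(δ_n)} → μ_σ` vaguely along every sequence of scales `δ_n → 0⁺` (Lemma 31 (i):
every subsequence has a convergence sub-sequence).
[cite: DKLM2026SixVertexGFF, Part II, proof of Theorem 53] -/
theorem halfPlaneVagueTendsto_gff_of_forall_isConvergenceSeq (hc : 0 < c) (hC : 0 ≤ C) {μinf : Measure (ℝ × ℝ)}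
    (hμinf : μinf ∈ dklmSpaceM c C) (σ : ℝ)
    (hid : ∀ (δ : ℕ → ℝ) (μ : Measure (ℝ × ℝ)), μ ∈ dklmSpaceM c C → IsConvergenceSeq μinf δ μ →
      μ = gffSpectralMeasure σ)
    {δ' : ℕ → ℝ} (hδ' : ∀ n, 0 < δ' n) (hδ'0 : Tendsto δ' atTop (𝓝 0)) :
    HalfPlaneVagueTendsto (fun n => scaleMeasure (δ' n) μinf) (gffSpectralMeasure σ) := by
  refine halfPlaneVagueTendsto_of_subseq fun φ hφ => ?_
  obtain ⟨ψ, hψ, μ, hμM, hconv⟩ := exists_isConvergenceSeq_subseq hc hC hμinf (δ' := δ' ∘ φ)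
    (fun n => hδ' (φ n)) (hδ'0.comp hφ.tendsto_atTop)
  refine ⟨ψ, hψ, ?_⟩
  rw [← hid _ μ hμM hconv]
  exact hconv.2.2

/-- **Theorem 53, uniqueness step via `Ψ`**: if every convergence-sequence limit `μ` of `μ_∞` has
two-point function `Ψ_μ = σ² Ψ₂^GFF` on the configurations of two horizontal pairs
`(m+1, 0, x₁', y₁', x₂, 0)`, then `μ_∞^{(δ_n)} → μ_σ` vaguely for all scales `δ_n → 0⁺` (the "simple
exercise" of §1.1 identifies `μ = μ_σ`). [cite: DKLM2026SixVertexGFF, Part II, proof of Theorem 53 and §1.1] -/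
theorem halfPlaneVagueTendsto_gff_of_forall_dklmPsi_eq (hc : 0 < c) (hC : 0 ≤ C) {μinf : Measure (ℝ × ℝ)}
    (hμinf : μinf ∈ dklmSpaceM c C) (σ : ℝ)
    (hΨ : ∀ (δ : ℕ → ℝ) (μ : Measure (ℝ × ℝ)), μ ∈ dklmSpaceM c C → IsConvergenceSeq μinf δ μ →
      ∀ (m : ℕ) (x₁' y₁' x₂ : ℝ), 0 < x₁' → 0 < x₂ →
        dklmPsi μ (m + 1) 0 x₁' y₁' x₂ 0 = ((σ ^ 2 * gffKPoint 2 (configOf (m + 1) 0 x₁' y₁' x₂ 0) : ℝ) : ℂ))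
    {δ' : ℕ → ℝ} (hδ' : ∀ n, 0 < δ' n) (hδ'0 : Tendsto δ' atTop (𝓝 0)) :
    HalfPlaneVagueTendsto (fun n => scaleMeasure (δ' n) μinf) (gffSpectralMeasure σ) :=
  halfPlaneVagueTendsto_gff_of_forall_isConvergenceSeq hc hC hμinf σ
    (fun δ μ hμ hconv => eq_gffSpectralMeasure_of_dklmPsi_eq hμ σ (hΨ δ μ hμ hconv)) hδ' hδ'0

/-! ## 3. Lattice approximation of points -/

/-- `δ_n ⌊t/δ_n⌋₊ → t` for `t ≥ 0` and scales `δ_n → 0⁺`. [folklore] -/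
theorem tendsto_mul_natFloor_div {δ : ℕ → ℝ} (hδ0 : ∀ n, 0 < δ n) (hδ : Tendsto δ atTop (𝓝 0)) {t : ℝ}
    (ht : 0 ≤ t) : Tendsto (fun n => δ n * (⌊t / δ n⌋₊ : ℝ)) atTop (𝓝 t) := by
  have hlo : ∀ n, t - δ n ≤ δ n * (⌊t / δ n⌋₊ : ℝ) := by
    intro n
    have h1 := Nat.lt_floor_add_one (t / δ n)
    have e : δ n * (t / δ n) = t := mul_div_cancel₀ t (hδ0 n).ne'
    nlinarith [hδ0 n]
  have hhi : ∀ n, δ n * (⌊t / δ n⌋₊ : ℝ) ≤ t := by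
    intro n
    have h1 := Nat.floor_le (div_nonneg ht (hδ0 n).le)
    have e : δ n * (t / δ n) = t := mul_div_cancel₀ t (hδ0 n).ne'
    nlinarith [hδ0 n]
  have hl : Tendsto (fun n => t - δ n) atTop (𝓝 t) := by simpa using tendsto_const_nhds.sub hδ
  exact tendsto_of_tendsto_of_tendsto_of_le_of_le hl tendsto_const_nhds hlo hhi

/-- `δ_n ⌈t/δ_n⌉₊ → t` for `t ≥ 0` and scales `δ_n → 0⁺`, with `δ_n ⌈t/δ_n⌉₊ ≥ t`. [folklore] -/
theorem tendsto_mul_natCeil_div {δ : ℕ → ℝ} (hδ0 : ∀ n, 0 < δ n) (hδ : Tendsto δ atTop (𝓝 0)) {t : ℝ}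
    (ht : 0 ≤ t) : Tendsto (fun n => δ n * (⌈t / δ n⌉₊ : ℝ)) atTop (𝓝 t) ∧ ∀ n, t ≤ δ n * (⌈t / δ n⌉₊ : ℝ) := by
  have hlo : ∀ n, t ≤ δ n * (⌈t / δ n⌉₊ : ℝ) := by
    intro n
    have h1 := Nat.le_ceil (t / δ n)
    have e : δ n * (t / δ n) = t := mul_div_cancel₀ t (hδ0 n).ne'
    nlinarith [hδ0 n]
  have hhi : ∀ n, δ n * (⌈t / δ n⌉₊ : ℝ) ≤ t + δ n := by
    intro n
    have h1 := Nat.ceil_lt_add_one (div_nonneg ht (hδ0 n).le)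
    have e : δ n * (t / δ n) = t := mul_div_cancel₀ t (hδ0 n).ne'
    nlinarith [hδ0 n]
  have hl : Tendsto (fun n => t + δ n) atTop (𝓝 t) := by simpa using tendsto_const_nhds.add hδ
  exact ⟨tendsto_of_tendsto_of_tendsto_of_le_of_le tendsto_const_nhds hl hlo hhi, hlo⟩

/-- `δ_n ⌊t/δ_n⌋ → t` for scales `δ_n → 0⁺` (integer floor). [folklore] -/
theorem tendsto_mul_intFloor_div {δ : ℕ → ℝ} (hδ0 : ∀ n, 0 < δ n) (hδ : Tendsto δ atTop (𝓝 0)) (t : ℝ) :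
    Tendsto (fun n => δ n * ((⌊t / δ n⌋ : ℤ) : ℝ)) atTop (𝓝 t) := by
  have := scaled_floor_sub_tendsto hδ0 hδ t 0
  simpa using this

/-! ## 4. `Ψ_μ = σ² Ψ₂^GFF` from the convergence of the lattice two-point function -/

/-- A real sequence tending to `0` is bounded above. [folklore] -/
theorem exists_upper_of_tendsto_zero {δ : ℕ → ℝ} (hδ : Tendsto δ atTop (𝓝 0)) : ∃ B : ℝ, ∀ n, δ n ≤ B := by
  obtain ⟨B, hB⟩ := hδ.isBoundedUnder_le.bddAbove_range
  exact ⟨B, fun n => hB ⟨n, rfl⟩⟩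

/-- **Lemma 34 + convergence of the two-point function identify `Ψ_μ`** (two horizontal pairs):
let `μ_∞ ∈ 𝓜_{c,C}` carry no mass on `{a ≥ 2}` and represent a lattice two-point function of two
horizontal pairs, `Φ₂(x₁,x₁',y₁',x₂) = ∫ χ^discr_{(x₁,0,x₁',y₁',x₂,0)} dμ_∞` for `x₁, x₁', x₂ ≥ 1`
(Theorem 23 with Lemma 32). If along a convergence sequence `(δ_n, μ)` the rescaled two-point
function converges to `σ² Ψ₂^GFF` at the lattice approximations `(⌈(m+1)/δ_n⌉, ⌈x₁'/δ_n⌉, ⌊y₁'/δ_n⌋, ⌈x₂/δ_n⌉)`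
of the configuration `(m+1, 0, x₁', y₁', x₂, 0)`, then `Ψ_μ = σ² Ψ₂^GFF` there.
[cite: DKLM2026SixVertexGFF, Part II, Lemma 34 and proof of Theorem 53] -/
theorem dklmPsi_eq_gff_of_tendsto_twoPoint (hc : 0 < c) (hC : 0 ≤ C) {μinf μ : Measure (ℝ × ℝ)}
    (hμinf : μinf ∈ dklmSpaceM c C) (hμ : μ ∈ dklmSpaceM c C) {δ : ℕ → ℝ} (hconv : IsConvergenceSeq μinf δ μ)
    (h2 : μinf {p : ℝ × ℝ | p.1 = 2} = 0) (h2' : μinf {p : ℝ × ℝ | 2 < p.1} = 0)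
    {Φ₂ : ℕ → ℕ → ℤ → ℕ → ℝ}
    (hrep : ∀ (x₁ x₁' : ℕ) (y₁' : ℤ) (x₂ : ℕ), 1 ≤ x₁ → 1 ≤ x₁' → 1 ≤ x₂ →
      ((Φ₂ x₁ x₁' y₁' x₂ : ℝ) : ℂ) = ∫ p, chiDiscr x₁ 0 x₁' y₁' x₂ 0 p ∂μinf)
    (σ : ℝ) (m : ℕ) (x₁' y₁' x₂ : ℝ) (hx₁' : 0 < x₁') (hx₂ : 0 < x₂)
    (hGFF : Tendsto (fun n => Φ₂ ⌈((m : ℝ) + 1) / δ n⌉₊ ⌈x₁' / δ n⌉₊ ⌊y₁' / δ n⌋ ⌈x₂ / δ n⌉₊) atTop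
        (𝓝 (σ ^ 2 * gffKPoint 2 (configOf (m + 1) 0 x₁' y₁' x₂ 0)))) :
    dklmPsi μ (m + 1) 0 x₁' y₁' x₂ 0 = ((σ ^ 2 * gffKPoint 2 (configOf (m + 1) 0 x₁' y₁' x₂ 0) : ℝ) : ℂ) := by
  obtain ⟨hδ0, hδ, _⟩ := hconv
  have hm : (0 : ℝ) < (m : ℝ) + 1 := by positivity
  obtain ⟨B, hB⟩ := exists_upper_of_tendsto_zero hδ
  -- the lattice approximants (ceilings for the horizontal widths, so that they are `≥ 1`)
  set kx₁ : ℕ → ℕ := fun n => ⌈((m : ℝ) + 1) / δ n⌉₊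
  set kx₁' : ℕ → ℕ := fun n => ⌈x₁' / δ n⌉₊
  set ky₁' : ℕ → ℤ := fun n => ⌊y₁' / δ n⌋
  set kx₂ : ℕ → ℕ := fun n => ⌈x₂ / δ n⌉₊
  obtain ⟨hkx₁, hX₁⟩ := tendsto_mul_natCeil_div hδ0 hδ hm.le
  obtain ⟨hkx₁', hX₀⟩ := tendsto_mul_natCeil_div hδ0 hδ hx₁'.le
  obtain ⟨hkx₂, hX₂l⟩ := tendsto_mul_natCeil_div hδ0 hδ hx₂.le
  have hpos : ∀ (t : ℝ), 0 < t → ∀ n, t ≤ δ n * (⌈t / δ n⌉₊ : ℝ) → 1 ≤ ⌈t / δ n⌉₊ := by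
    intro t ht n h1
    by_contra h0
    push Not at h0
    have : ⌈t / δ n⌉₊ = 0 := by omega
    rw [this, Nat.cast_zero, mul_zero] at h1
    linarith
  -- an upper bound for `δ_n ⌈x₂/δ_n⌉ ≤ x₂ + δ_n ≤ x₂ + B`
  have hX₂ : ∀ n, δ n * (kx₂ n : ℝ) ≤ x₂ + B := by
    intro n
    have h1 := Nat.ceil_lt_add_one (div_nonneg hx₂.le (hδ0 n).le)
    have e : δ n * (x₂ / δ n) = x₂ := mul_div_cancel₀ x₂ (hδ0 n).ne'
    show δ n * (⌈x₂ / δ n⌉₊ : ℝ) ≤ x₂ + B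
    nlinarith [hδ0 n, hB n]
  -- Lemma 34 along the convergence sequence (first pair horizontal: `y₁ = 0`)
  set Φ : ℕ → ℝ := fun n => Φ₂ (kx₁ n) (kx₁' n) (ky₁' n) (kx₂ n) with hΦ
  have hy0 : Tendsto (fun n => δ n * (((0 : ℤ) : ℝ))) atTop (𝓝 0) := by simp
  have hlim := scalingLimit_spectral_representation hc hC hμinf hμ ⟨hδ0, hδ, ‹_›⟩ h2 h2'
    (kx₁ := kx₁) (kx₁' := kx₁') (kx₂ := kx₂) (ky₁' := ky₁') (ky₂ := fun _ => 0)
    hkx₁ hkx₁' (tendsto_mul_intFloor_div hδ0 hδ y₁') hkx₂ hy0 hx₁' hX₀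
    (X₁ := (m : ℝ) + 1 + B) (fun n => by
      have h1 := Nat.ceil_lt_add_one (div_nonneg hm.le (hδ0 n).le)
      have e : δ n * ((((m : ℝ) + 1)) / δ n) = (m : ℝ) + 1 := mul_div_cancel₀ _ (hδ0 n).ne'
      show δ n * (⌈((m : ℝ) + 1) / δ n⌉₊ : ℝ) ≤ (m : ℝ) + 1 + B
      nlinarith [hδ0 n, hB n])
    (Φ := Φ) (fun n => by
      have := hrep (kx₁ n) (kx₁' n) (ky₁' n) (kx₂ n) (hpos _ hm n (hX₁ n)) (hpos _ hx₁' n (hX₀ n))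
        (hpos _ hx₂ n (hX₂l n))
      simpa only [Int.cast_zero] using this)
  -- the same sequence converges to `σ² Ψ₂^GFF`
  have hlim2 : Tendsto (fun n => ((Φ n : ℝ) : ℂ)) atTop
      (𝓝 (((σ ^ 2 * gffKPoint 2 (configOf (m + 1) 0 x₁' y₁' x₂ 0) : ℝ) : ℂ))) :=
    (Complex.continuous_ofReal.tendsto _).comp hGFF
  have := tendsto_nhds_unique hlim hlim2
  push_cast at this ⊢
  exact this.symm ▸ rfl

/-- **Theorem 53 for a full-plane spectral measure `μ_∞`**: if `μ_∞ ∈ 𝓜_{c,C}` (`c > 0`) carries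
no mass on `{a ≥ 2}`, represents the lattice two-point function of two horizontal pairs
(`Φ₂ = ∫ χ^discr dμ_∞`, Theorem 23 and Lemma 32), and the rescaled two-point function converges
to `σ² Ψ₂^GFF` along every convergence sequence of scales at the lattice approximations of the
configurations `(m+1, 0, x₁', y₁', x₂, 0)`, then `μ_∞^{(δ_n)} → μ_σ = ½(δ_{b=a}+δ_{b=-a}) ⊗ σ²/(2πa) 𝟙_{a>0} da`
vaguely for every sequence of scales `δ_n → 0⁺`. [cite: DKLM2026SixVertexGFF, Part II, Theorem 53] -/
theorem halfPlaneVagueTendsto_gff_of_tendsto_twoPoint (hc : 0 < c) (hC : 0 ≤ C) {μinf : Measure (ℝ × ℝ)}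
    (hμinf : μinf ∈ dklmSpaceM c C) (h2 : μinf {p : ℝ × ℝ | p.1 = 2} = 0) (h2' : μinf {p : ℝ × ℝ | 2 < p.1} = 0)
    {Φ₂ : ℕ → ℕ → ℤ → ℕ → ℝ}
    (hrep : ∀ (x₁ x₁' : ℕ) (y₁' : ℤ) (x₂ : ℕ), 1 ≤ x₁ → 1 ≤ x₁' → 1 ≤ x₂ →
      ((Φ₂ x₁ x₁' y₁' x₂ : ℝ) : ℂ) = ∫ p, chiDiscr x₁ 0 x₁' y₁' x₂ 0 p ∂μinf)
    (σ : ℝ)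
    (hGFF : ∀ (δ : ℕ → ℝ), (∀ n, 0 < δ n) → Tendsto δ atTop (𝓝 0) →
      ∀ (m : ℕ) (x₁' y₁' x₂ : ℝ), 0 < x₁' → 0 < x₂ →
        Tendsto (fun n => Φ₂ ⌈((m : ℝ) + 1) / δ n⌉₊ ⌈x₁' / δ n⌉₊ ⌊y₁' / δ n⌋ ⌈x₂ / δ n⌉₊) atTop
          (𝓝 (σ ^ 2 * gffKPoint 2 (configOf (m + 1) 0 x₁' y₁' x₂ 0))))
    {δ' : ℕ → ℝ} (hδ' : ∀ n, 0 < δ' n) (hδ'0 : Tendsto δ' atTop (𝓝 0)) :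
    HalfPlaneVagueTendsto (fun n => scaleMeasure (δ' n) μinf) (gffSpectralMeasure σ) :=
  halfPlaneVagueTendsto_gff_of_forall_dklmPsi_eq hc hC hμinf σ
    (fun δ _ hμ hconv m x₁' y₁' x₂ hx₁' hx₂ => dklmPsi_eq_gff_of_tendsto_twoPoint hc hC hμinf hμ hconv h2 h2' hrep σ
      m x₁' y₁' x₂ hx₁' hx₂ (hGFF δ hconv.1 hconv.2.1 m x₁' y₁' x₂ hx₁' hx₂)) hδ' hδ'0

end Literature.Probability.LatticeModels.SixVertex

end
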